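import Literature.MathematicalPhysics.QuantumLattice.LTQOFrustrationFreeProofs
import Literature.MathematicalPhysics.QuantumLattice.QuasiLocalAverageProofs
import Literature.MathematicalPhysics.QuantumLattice.LatticeToriProofs
import HarnessLib

/-!
# LTQO for centred (quasi-local) observables

Twentieth file of the formalisation of the Michalakis–Zwolak stability theorem (hubbard.S19):
the engine of MZ13 §6 Lemma 3 ("using Local-TQO and the decomposition of `X_u`, `‖Δ_u‖`
decays rapidly"). An observable `O` that is only centred at `x` — quasi-local with tails
`‖O − 𝔼_{b_x(r+m)ᶜ}(O)‖ ≤ E m` rather than strictly supported on a ball — still satisfies the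
LTQO estimate after splitting at a scale `ℓ`: for `2(r+ℓ+ℓ') < L` and any region
`B' ⊇ b_x(r+ℓ+ℓ')` (in particular the whole torus, where `P_{B'} = P₀` is the ground-state
projector), `‖P_{B'} O P_{B'} − c • P_{B'}‖ ≤ ‖O‖ Δ(ℓ') + E(ℓ)`
(`HasLTQO.norm_conj_sub_smul_le_of_centred`; the local part is handled by LTQO transferred to
`B'` through frustration-freeness, `HasLTQO.norm_conj_sub_smul_le_of_subset`, and the tail is
compressed contractively, `norm_proj_mul_mul_proj_le`).

Second part (appended): **MZ13 Corollary 1 (2), local indistinguishability**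
(`HasLTQO.norm_mul_localGroundProj_le`: `‖A P_{B'}‖ ≤ ‖A P₀‖ + ‖A‖√(2Δ(ℓ))` for `A` on
`b_x(r)`, `B' ⊇ b_x(r+ℓ)`, from LTQO for `A†A` at the ball and at the torus with the same
constant and the C⋆-identity), and its consequence for centred perturbations commuting with
`P₀` (`norm_localGroundProj_mul_centred_le`: `‖P_{b_x(R)} Y‖ ≤ ‖P₀ Y P₀‖ + 2E(m) + ‖Y‖√(2Δ(ℓ))`
for `R = r₀+m+ℓ`, `2R < L`; `norm_localGroundProj_mul_eq_of_large` for `2R ≥ L`, where the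
ball is the whole torus, `cellBall_eq_univ`), the estimate (bound1) of the proof of MZ13
Lemma 4; `localGroundProj_chain_nested` records the nesting of the chain `P_{b_x(r₀+k)}`.
No definitions, no named facts (theorems only).
-/

noncomputable section

open Matrix Complex Finset
open scoped Matrix.Norms.L2Operator

namespace Literature.MathematicalPhysics.QuantumLattice

open Literature.Probability.LatticeModels

variable {d L : ℕ} [NeZero L] {κ : Type*} [Fintype κ] [DecidableEq κ] {q : ℕ}

/-- Compression by a projection is contractive: `‖P Y P‖ ≤ ‖Y‖` for a Hermitian idempotent `P`.
[folklore] -/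
theorem norm_proj_mul_mul_proj_le {n : Type*} [Fintype n] [DecidableEq n] {P : Matrix n n ℂ}
    (hP : P.IsHermitian) (hP2 : IsIdempotentElem P) (Y : Matrix n n ℂ) : ‖P * Y * P‖ ≤ ‖Y‖ := by
  have h1 := norm_le_one_of_isHermitian_of_isIdempotentElem hP hP2.eq
  calc ‖P * Y * P‖ ≤ ‖P * Y‖ * ‖P‖ := norm_mul_le _ _
    _ ≤ ‖P‖ * ‖Y‖ * ‖P‖ := mul_le_mul_of_nonneg_right (norm_mul_le _ _) (norm_nonneg _)
    _ ≤ 1 * ‖Y‖ * 1 := by gcongr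
    _ = ‖Y‖ := by ring

/-- **LTQO for centred observables (the engine of MZ13 Lemma 3).** Let `Φ` have LTQO with rate
`Δ`, and let `O` be centred at `x` with radius `r` and tails `E`
(`‖O − 𝔼_{b_x(r+m)ᶜ}(O)‖ ≤ E m`). For scales `ℓ`, `ℓ'` with `2(r+ℓ+ℓ') < L` and every region
`B' ⊇ b_x(r+ℓ+ℓ')` (in particular the whole torus, `P_{B'} = P₀`):
`‖P_{B'} O P_{B'} − c • P_{B'}‖ ≤ ‖O‖ Δ(ℓ') + E(ℓ)` with the LTQO constant `c` of the local part
of `O` at scale `ℓ` (split `O` at scale `ℓ`; LTQO for the local part transferred to `B'` by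
frustration-freeness, `HasLTQO.norm_conj_sub_smul_le_of_subset`; the tail is compressed
contractively). [cite: MichalakisZwolakCMP2013, §6 Lemma 3 (arXiv:1109.1588 p. 12)] -/
theorem HasLTQO.norm_conj_sub_smul_le_of_centred {Φ : Interaction (TorusSite d L × κ) q}
    {Δ : ℕ → ℝ} (h : HasLTQO Φ Δ) {x : TorusSite d L} {r : ℕ} {O : Op (TorusSite d L × κ) q}
    {E : ℕ → ℝ} (hcent : ∀ m : ℕ, ‖O - twirl (cellBall x (r + m))ᶜ O‖ ≤ E m) {ℓ ℓ' : ℕ}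
    (hΔ0 : 0 ≤ Δ ℓ') (hL : 2 * (r + ℓ + ℓ') < L) {B' : Finset (TorusSite d L × κ)}
    (hB' : cellBall x (r + ℓ + ℓ') ⊆ B') :
    ‖localGroundProj Φ B' * O * localGroundProj Φ B' -
        ltqoConst (localGroundProj Φ (cellBall x (r + ℓ + ℓ')))
          (twirl (cellBall x (r + ℓ))ᶜ O) • localGroundProj Φ B'‖ ≤ ‖O‖ * Δ ℓ' + E ℓ := by
  set Oℓ : Op (TorusSite d L × κ) q := twirl (cellBall x (r + ℓ))ᶜ O with hOℓ
  set P : Op (TorusSite d L × κ) q := localGroundProj Φ B' with hP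
  have hOℓ_supp : IsSupportedOn Oℓ (cellBall x (r + ℓ)) := isSupportedOn_twirl_compl _ O
  have hOℓ_norm : ‖Oℓ‖ ≤ ‖O‖ := norm_twirl_le _ O
  -- LTQO for the local part, transferred to `B'`
  have h1 := h.norm_conj_sub_smul_le_of_subset hOℓ_supp (r := r + ℓ) (ℓ := ℓ') hL (B' := B') hB'
  -- the tail
  have h2 : ‖P * (O - Oℓ) * P‖ ≤ E ℓ :=
    (norm_proj_mul_mul_proj_le (localGroundProj_isHermitian Φ B') (localGroundProj_idempotent Φ B')
      _).trans (hcent ℓ)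
  have hsplit : P * O * P - ltqoConst (localGroundProj Φ (cellBall x (r + ℓ + ℓ'))) Oℓ • P =
      (P * Oℓ * P - ltqoConst (localGroundProj Φ (cellBall x (r + ℓ + ℓ'))) Oℓ • P) +
        P * (O - Oℓ) * P := by
    simp only [Matrix.mul_sub, Matrix.sub_mul]; abel
  rw [hsplit]
  refine (norm_add_le _ _).trans (add_le_add (h1.trans ?_) h2)
  exact mul_le_mul_of_nonneg_right hOℓ_norm hΔ0

/-! ### MZ13 Corollary 1 (2): local indistinguishability of the ground spaces -/

/-- `√(a² + b) ≤ a + √b` for `a, b ≥ 0`. [folklore] -/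
theorem sqrt_sq_add_le {a b : ℝ} (ha : 0 ≤ a) (hb : 0 ≤ b) : Real.sqrt (a ^ 2 + b) ≤ a + Real.sqrt b := by
  rw [Real.sqrt_le_left (by positivity)]
  nlinarith [Real.sq_sqrt hb, Real.sqrt_nonneg b]

/-- **MZ13 Corollary 1 (2) (local indistinguishability).** Under LTQO with rate `Δ`, for an
observable `A` supported on `b_x(r)`, `2(r+ℓ) < L`, and every region `B' ⊇ b_x(r+ℓ)`:
`‖A P_{B'}‖ ≤ ‖A P₀‖ + ‖A‖ √(2 Δ(ℓ))` (`P₀ = P_Λ ≠ 0` the ground-state projector): a local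
observable that nearly annihilates the global ground states nearly annihilates the local ones.
Proof: LTQO for `A†A` at the ball and, transferred by frustration-freeness, at `Λ`, with the
same constant `c`; `‖A P‖² = ‖P A†A P‖` (C⋆-identity).
[cite: MichalakisZwolakCMP2013, §4 Corollary 1 (claim 2) (arXiv:1109.1588 p. 7)] -/
theorem HasLTQO.norm_mul_localGroundProj_le {Φ : Interaction (TorusSite d L × κ) q}
    {Δ : ℕ → ℝ} (h : HasLTQO Φ Δ) {x : TorusSite d L} {r ℓ : ℕ} {A : Op (TorusSite d L × κ) q}
    (hA : IsSupportedOn A (cellBall x r)) (hL : 2 * (r + ℓ) < L) (hΔ0 : 0 ≤ Δ ℓ)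
    {B' : Finset (TorusSite d L × κ)} (hB' : cellBall x (r + ℓ) ⊆ B')
    (hP0 : ‖localGroundProj Φ (univ : Finset (TorusSite d L × κ))‖ = 1) :
    ‖A * localGroundProj Φ B'‖ ≤
      ‖A * localGroundProj Φ univ‖ + ‖A‖ * Real.sqrt (2 * Δ ℓ) := by
  set Pb := localGroundProj Φ (cellBall x (r + ℓ)) with hPb
  set P0 := localGroundProj Φ (univ : Finset (TorusSite d L × κ)) with hP0def
  set O : Op (TorusSite d L × κ) q := Aᴴ * A with hO
  have hOsupp : IsSupportedOn O (cellBall x r) := by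
    rw [hO, ← star_eq_conjTranspose]; exact IsSupportedOn.mul_holds hA.star hA
  have hOnorm : ‖O‖ = ‖A‖ ^ 2 := by
    rw [hO, ← star_eq_conjTranspose, CStarRing.norm_star_mul_self, sq]
  -- LTQO at the ball and at the whole torus, same constant
  have h1 : ‖Pb * O * Pb - ltqoConst Pb O • Pb‖ ≤ ‖O‖ * Δ ℓ := h x r ℓ O hOsupp hL
  have h2 : ‖P0 * O * P0 - ltqoConst Pb O • P0‖ ≤ ‖O‖ * Δ ℓ :=
    h.norm_conj_sub_smul_le_of_subset hOsupp hL (B' := univ) (subset_univ _)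
  -- the C⋆ identity
  have hsq : ∀ {P : Op (TorusSite d L × κ) q}, P.IsHermitian → ‖P * O * P‖ = ‖A * P‖ ^ 2 := by
    intro P hP
    have : P * O * P = star (A * P) * (A * P) := by
      rw [star_eq_conjTranspose, conjTranspose_mul, hP.eq, hO, Matrix.mul_assoc, Matrix.mul_assoc,
        Matrix.mul_assoc]
    rw [this, CStarRing.norm_star_mul_self, sq]
  have hPbh : Pb.IsHermitian := localGroundProj_isHermitian Φ _
  have hP0h : P0.IsHermitian := localGroundProj_isHermitian Φ _
  have hPb1 : ‖Pb‖ ≤ 1 :=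
    norm_le_one_of_isHermitian_of_isIdempotentElem hPbh (localGroundProj_idempotent Φ _).eq
  -- `|c| ≤ ‖A P₀‖² + ‖A‖² Δ`
  have hc : ‖ltqoConst Pb O‖ ≤ ‖A * P0‖ ^ 2 + ‖A‖ ^ 2 * Δ ℓ := by
    have hcP : ‖ltqoConst Pb O • P0‖ = ‖ltqoConst Pb O‖ := by rw [norm_smul, hP0, mul_one]
    calc ‖ltqoConst Pb O‖ = ‖ltqoConst Pb O • P0‖ := hcP.symm
      _ = ‖P0 * O * P0 - (P0 * O * P0 - ltqoConst Pb O • P0)‖ := by rw [sub_sub_cancel]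
      _ ≤ ‖P0 * O * P0‖ + ‖P0 * O * P0 - ltqoConst Pb O • P0‖ := norm_sub_le _ _
      _ ≤ ‖A * P0‖ ^ 2 + ‖O‖ * Δ ℓ := by rw [hsq hP0h]; exact add_le_add le_rfl h2
      _ = ‖A * P0‖ ^ 2 + ‖A‖ ^ 2 * Δ ℓ := by rw [hOnorm]
  -- `‖A P_b‖² ≤ |c| + ‖A‖² Δ`
  have hb : ‖A * Pb‖ ^ 2 ≤ ‖A * P0‖ ^ 2 + 2 * (‖A‖ ^ 2 * Δ ℓ) := by
    calc ‖A * Pb‖ ^ 2 = ‖Pb * O * Pb‖ := (hsq hPbh).symm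
      _ = ‖(Pb * O * Pb - ltqoConst Pb O • Pb) + ltqoConst Pb O • Pb‖ := by rw [sub_add_cancel]
      _ ≤ ‖Pb * O * Pb - ltqoConst Pb O • Pb‖ + ‖ltqoConst Pb O • Pb‖ := norm_add_le _ _
      _ ≤ ‖O‖ * Δ ℓ + ‖ltqoConst Pb O‖ * 1 := by
          refine add_le_add h1 ?_
          rw [norm_smul]; exact mul_le_mul_of_nonneg_left hPb1 (norm_nonneg _)
      _ ≤ ‖A‖ ^ 2 * Δ ℓ + (‖A * P0‖ ^ 2 + ‖A‖ ^ 2 * Δ ℓ) := by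
          rw [hOnorm, mul_one]; exact add_le_add le_rfl hc
      _ = ‖A * P0‖ ^ 2 + 2 * (‖A‖ ^ 2 * Δ ℓ) := by ring
  -- take square roots
  have hb' : ‖A * Pb‖ ≤ ‖A * P0‖ + ‖A‖ * Real.sqrt (2 * Δ ℓ) := by
    have h0 : 0 ≤ ‖A * Pb‖ := norm_nonneg _
    calc ‖A * Pb‖ = Real.sqrt (‖A * Pb‖ ^ 2) := (Real.sqrt_sq h0).symm
      _ ≤ Real.sqrt (‖A * P0‖ ^ 2 + 2 * (‖A‖ ^ 2 * Δ ℓ)) := Real.sqrt_le_sqrt hb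
      _ ≤ ‖A * P0‖ + Real.sqrt (2 * (‖A‖ ^ 2 * Δ ℓ)) :=
          sqrt_sq_add_le (norm_nonneg _) (mul_nonneg zero_le_two (mul_nonneg (sq_nonneg _) hΔ0))
      _ = ‖A * P0‖ + ‖A‖ * Real.sqrt (2 * Δ ℓ) := by
          rw [show 2 * (‖A‖ ^ 2 * Δ ℓ) = ‖A‖ ^ 2 * (2 * Δ ℓ) by ring,
            Real.sqrt_mul (sq_nonneg _), Real.sqrt_sq (norm_nonneg _)]
  -- pass to `B' ⊇ b`
  have hPbB : Pb * localGroundProj Φ B' = localGroundProj Φ B' := localGroundProj_mul_of_superset Φ hB'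
  have hB1 : ‖localGroundProj Φ B'‖ ≤ 1 :=
    norm_le_one_of_isHermitian_of_isIdempotentElem (localGroundProj_isHermitian Φ _)
      (localGroundProj_idempotent Φ _).eq
  calc ‖A * localGroundProj Φ B'‖ = ‖A * Pb * localGroundProj Φ B'‖ := by rw [Matrix.mul_assoc, hPbB]
    _ ≤ ‖A * Pb‖ * ‖localGroundProj Φ B'‖ := norm_mul_le _ _
    _ ≤ ‖A * Pb‖ * 1 := mul_le_mul_of_nonneg_left hB1 (norm_nonneg _)
    _ ≤ _ := by rw [mul_one]; exact hb'


/-! ### The shells of local ground-state projectors on the torus, and their norms -/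

section TorusShells

open Finset Literature.Probability.LatticeModels

variable {d L : ℕ} [NeZero L] {κ : Type*} [Fintype κ] [DecidableEq κ] {q : ℕ}

omit [DecidableEq κ] in
/-- Every coordinate's cyclic absolute value is at most `L/2`, hence so is the torus distance:
balls of radius `≥ L/2` are the whole torus. [folklore] -/
theorem cellBall_eq_univ {x : TorusSite d L} {R : ℕ} (hR : L ≤ 2 * R) :
    (cellBall x R : Finset (TorusSite d L × κ)) = univ := by
  refine eq_univ_of_forall fun y => mem_cellBall_iff.2 ?_
  unfold torusDist torusNorm
  refine Finset.sup_le fun i _ => ?_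
  have h := ZMod.val_lt ((x - y.1) i)
  change min ((x - y.1) i).val (L - ((x - y.1) i).val) ≤ R
  omega

/-- The chain `Q_k = P_{b_x(r₀+k)}` of local ground-state projectors of growing balls is nested:
`Q_j Q_k = Q_j` and `Q_k Q_j = Q_j` for `k ≤ j` (frustration-freeness, MZ13 Corollary 1 (3)).
[folklore] -/
theorem localGroundProj_chain_nested (Φ : Interaction (TorusSite d L × κ) q) (x : TorusSite d L)
    (r₀ : ℕ) :
    (∀ k j : ℕ, k ≤ j → localGroundProj Φ (cellBall x (r₀ + j)) * localGroundProj Φ (cellBall x (r₀ + k)) =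
      localGroundProj Φ (cellBall x (r₀ + j))) ∧
    (∀ k j : ℕ, k ≤ j → localGroundProj Φ (cellBall x (r₀ + k)) * localGroundProj Φ (cellBall x (r₀ + j)) =
      localGroundProj Φ (cellBall x (r₀ + j))) :=
  ⟨fun k j hkj => localGroundProj_mul_of_subset_holds Φ (cellBall_mono x (by omega)),
   fun k j hkj => localGroundProj_mul_of_superset Φ (cellBall_mono x (by omega))⟩

/-- For a Hermitian `Y` commuting with a Hermitian idempotent `P`: `‖Y P‖ = ‖P Y P‖`. [folklore] -/
theorem norm_mul_proj_eq_of_commute {n : Type*} [Fintype n] [DecidableEq n] {Y P : Matrix n n ℂ}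
    (hP2 : P * P = P) (hc : P * Y = Y * P) : ‖Y * P‖ = ‖P * Y * P‖ := by
  rw [Matrix.mul_assoc, ← hc, ← Matrix.mul_assoc, hP2, hc]

/-- For Hermitian `Y`, `P`: `‖P Y‖ = ‖Y P‖`. [folklore] -/
theorem norm_proj_mul_eq_norm_mul_proj {n : Type*} [Fintype n] [DecidableEq n] {Y P : Matrix n n ℂ}
    (hY : Y.IsHermitian) (hP : P.IsHermitian) : ‖P * Y‖ = ‖Y * P‖ := by
  rw [← l2_opNorm_conjTranspose (P * Y), conjTranspose_mul, hY.eq, hP.eq]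

/-- **Norm of a local ground-state projector against a centred perturbation (MZ13 Lemma 4, the
estimate (bound1)).** Let `Y` be Hermitian, commuting with the ground-state projector `P₀`, and
centred at `x` with radius `r₀` and tails `E`. For a radius `R = r₀ + m + ℓ` with `2R < L`:
`‖P_{b_x(R)} Y‖ ≤ ‖P₀ Y P₀‖ + 2 E(m) + ‖Y‖ √(2Δ(ℓ))`
(split `Y` at scale `m`; local indistinguishability `HasLTQO.norm_mul_localGroundProj_le` for the
local part; `Y P₀ = P₀ Y P₀`). [folklore] -/
theorem norm_localGroundProj_mul_centred_le {Φ : Interaction (TorusSite d L × κ) q} {Δ : ℕ → ℝ}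
    (hLTQO : HasLTQO Φ Δ) {x : TorusSite d L} {r₀ m ℓ : ℕ} (hL : 2 * (r₀ + m + ℓ) < L)
    (hΔ0 : 0 ≤ Δ ℓ) (hP0 : ‖localGroundProj Φ (univ : Finset (TorusSite d L × κ))‖ = 1)
    {Y : Op (TorusSite d L × κ) q} (hY : Y.IsHermitian)
    (hcomm : localGroundProj Φ univ * Y = Y * localGroundProj Φ univ)
    {E : ℕ → ℝ} (hcent : ∀ m' : ℕ, ‖Y - twirl (cellBall x (r₀ + m'))ᶜ Y‖ ≤ E m')
    {B' : Finset (TorusSite d L × κ)} (hB' : cellBall x (r₀ + m + ℓ) ⊆ B') :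
    ‖localGroundProj Φ B' * Y‖ ≤
      ‖localGroundProj Φ univ * Y * localGroundProj Φ univ‖ + 2 * E m + ‖Y‖ * Real.sqrt (2 * Δ ℓ) := by
  set Ym : Op (TorusSite d L × κ) q := twirl (cellBall x (r₀ + m))ᶜ Y with hYm
  set P0 := localGroundProj Φ (univ : Finset (TorusSite d L × κ)) with hP0def
  set PB := localGroundProj Φ B' with hPB
  have hYm_supp : IsSupportedOn Ym (cellBall x (r₀ + m)) := isSupportedOn_twirl_compl _ Y
  have hYm_norm : ‖Ym‖ ≤ ‖Y‖ := norm_twirl_le _ Y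
  have hdiff : ‖Y - Ym‖ ≤ E m := hcent m
  have hPBh : PB.IsHermitian := localGroundProj_isHermitian Φ _
  have hP0h : P0.IsHermitian := localGroundProj_isHermitian Φ _
  have hPB1 : ‖PB‖ ≤ 1 :=
    norm_le_one_of_isHermitian_of_isIdempotentElem hPBh (localGroundProj_idempotent Φ _).eq
  have hP01 : ‖P0‖ ≤ 1 := by rw [hP0]
  -- `‖P_B Y‖ = ‖Y P_B‖ ≤ ‖Ym P_B‖ + E m`
  rw [norm_proj_mul_eq_norm_mul_proj hY hPBh]
  have h1 : ‖Y * PB‖ ≤ ‖Ym * PB‖ + E m := by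
    calc ‖Y * PB‖ = ‖Ym * PB + (Y - Ym) * PB‖ := by rw [Matrix.sub_mul, add_sub_cancel]
      _ ≤ ‖Ym * PB‖ + ‖(Y - Ym) * PB‖ := norm_add_le _ _
      _ ≤ ‖Ym * PB‖ + ‖Y - Ym‖ * ‖PB‖ := add_le_add le_rfl (norm_mul_le _ _)
      _ ≤ ‖Ym * PB‖ + E m * 1 := add_le_add le_rfl
          (mul_le_mul hdiff hPB1 (norm_nonneg _) ((norm_nonneg _).trans hdiff))
      _ = _ := by rw [mul_one]
  -- local indistinguishability for `Ym`
  have h2 : ‖Ym * PB‖ ≤ ‖Ym * P0‖ + ‖Ym‖ * Real.sqrt (2 * Δ ℓ) :=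
    hLTQO.norm_mul_localGroundProj_le hYm_supp (r := r₀ + m) (ℓ := ℓ) hL hΔ0 hB' hP0
  -- back to `Y`: `‖Ym P₀‖ ≤ ‖Y P₀‖ + E m = ‖P₀ Y P₀‖ + E m`
  have h3 : ‖Ym * P0‖ ≤ ‖P0 * Y * P0‖ + E m := by
    have hYP : ‖Y * P0‖ = ‖P0 * Y * P0‖ :=
      norm_mul_proj_eq_of_commute (localGroundProj_idempotent Φ _).eq hcomm
    calc ‖Ym * P0‖ = ‖Y * P0 - (Y - Ym) * P0‖ := by rw [Matrix.sub_mul, sub_sub_cancel]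
      _ ≤ ‖Y * P0‖ + ‖(Y - Ym) * P0‖ := norm_sub_le _ _
      _ ≤ ‖Y * P0‖ + ‖Y - Ym‖ * ‖P0‖ := add_le_add le_rfl (norm_mul_le _ _)
      _ ≤ ‖P0 * Y * P0‖ + E m * 1 := by
          rw [hYP]
          exact add_le_add le_rfl (mul_le_mul hdiff hP01 (norm_nonneg _) ((norm_nonneg _).trans hdiff))
      _ = _ := by rw [mul_one]
  have h4 : ‖Ym‖ * Real.sqrt (2 * Δ ℓ) ≤ ‖Y‖ * Real.sqrt (2 * Δ ℓ) :=
    mul_le_mul_of_nonneg_right hYm_norm (Real.sqrt_nonneg _)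
  linarith

/-- At radii `R ≥ L/2` the ball is the whole torus and `‖P_{b(R)} Y‖ = ‖P₀ Y P₀‖` for `Y`
commuting with `P₀`. [folklore] -/
theorem norm_localGroundProj_mul_eq_of_large {Φ : Interaction (TorusSite d L × κ) q}
    {x : TorusSite d L} {R : ℕ} (hR : L ≤ 2 * R) {Y : Op (TorusSite d L × κ) q} (hY : Y.IsHermitian)
    (hcomm : localGroundProj Φ univ * Y = Y * localGroundProj Φ univ) :
    ‖localGroundProj Φ (cellBall x R : Finset (TorusSite d L × κ)) * Y‖ =
      ‖localGroundProj Φ univ * Y * localGroundProj Φ univ‖ := by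
  rw [cellBall_eq_univ hR, norm_proj_mul_eq_norm_mul_proj hY (localGroundProj_isHermitian Φ _)]
  exact norm_mul_proj_eq_of_commute (localGroundProj_idempotent Φ _).eq hcomm

end TorusShells

end Literature.MathematicalPhysics.QuantumLattice
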